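import Summits.RiemannHypothesis.RiemannHypothesis.Theorems.DBNBoundaryReduction
import Summits.RiemannHypothesis.RiemannHypothesis.Theorems.DBNCornerFreeDescent
import HarnessLib

/-!
# RiemannHypothesis / DBN — T13 `BoundaryReductionSlack`: boundary reduction WITH SLACK

RH-FREE (THEORY-R4 §2 of the `pub-dbn` cell, `Sketch4.lean` sha16 3a8b9a024097398f; support-grade,
SHARPENS T1a, does not lower Λ).  If `cᵢ > 1` and the signed kernel `k = Σ wᵢ S_{cᵢ,κᵢ,uᵢ}` satisfies
the 1-D inequality `k(ξ,1) ≤ 4/(ξ²+4)` for all `ξ`, then on the open strip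
`k(ξ,η) + 2π·Q^{(η)}(ξ) ≤ P(ξ,η)`, `2π·Q^{(η)}(ξ) = π cos(πη/2) cosh(πξ/2)/(cosh²(πξ/2) − sin²(πη/2))`
— the interior margin is `2π ×` the harmonic measure of the corner poles.  Proof: Mathlib's
`PhragmenLindelof.horizontal_strip` for `F = exp(Σ wᵢ Kᵢ − G̃)` with `G̃` the holomorphic extension of
`4/(1+w²) − π sech(πw/2)` across the corners (`DBNCornerFreeDescent.lean`): on the boundary lines
`Re G̃ = 4/(ξ²+4)` (and `= 1` at the corners, where 1-D admissibility gives `k(0,±1) ≤ 1`), `F` is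
bounded far out, hence `‖F‖ ≤ 1` inside, i.e. `k ≤ Re G = P − 2πQ`.  The statement is byte-verbatim
`DbnTheory4.BoundaryReductionSlack`; it implies the hard direction of T1a (`Q > 0` inside).

`--supports stmt-RiemannHypothesis-0274`; nothing here bears on the truth of RH.
-/

noncomputable section

-- D-0017: `Summit.<S>.<S>.…` is the designed namespace of a single-problem summit.
set_option linter.dupNamespace false

open scoped Real
open MeasureTheory Set intervalIntegral Complex Filter Topology

namespace Summit.RiemannHypothesis.RiemannHypothesis.Theorems.DbnTheory

/-! ## T13: boundary reduction WITH SLACK -/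

/-- TARGET T13 (RH-FREE, support-grade; sharpens T1a) — boundary reduction WITH SLACK: a signed kernel
admissible on the line is dominated on the open strip by `P − 2π·Q^{(η)}`.  Verbatim
`DbnTheory4.BoundaryReductionSlack` (Sketch4.lean). -/
def BoundaryReductionSlack : Prop :=
  ∀ (n : ℕ) (w c κ u : Fin n → ℝ), (∀ i, 1 < c i) → Admissible1D w c κ u →
    ∀ ξ η : ℝ, |η| < 1 → signedKernel w c κ u ξ η + 2 * π * stripKernel η ξ ≤ descentKernel ξ η

/-- **`BoundaryReductionSlack`** (T13, THEORY-R4 §2): Phragmén–Lindelöf on the strip for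
`F = exp(Σ wᵢ Kᵢ − G̃)`, `G̃` the holomorphic extension of `4/(1+w²) − π sech(πw/2)` across the corners:
on the boundary lines `Re G̃ = 4/(ξ²+4)` (`= 1` at the corners by continuity) dominates `k(·,±1)` by 1-D
admissibility, `F` is bounded far out, hence `‖F‖ ≤ 1` inside, i.e. `k ≤ Re G = P − 2πQ`. [folklore] -/
theorem BoundaryReductionSlack_holds : BoundaryReductionSlack := by
  intro n w c κ u hc h1D ξ η hη
  set F : ℂ → ℂ := fun z => Complex.exp (∑ i, (w i : ℂ) * (∫ v in (-1:ℝ)..1, ((biweight v : ℝ) : ℂ) *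
      (((c i : ℂ) + Complex.I * (z - u i - κ i * v))⁻¹ + ((c i : ℂ) - Complex.I * (z - u i - κ i * v))⁻¹))
      - cornerFreeDescentExt z) with hF
  -- modulus on the closed strip
  have hnorm : ∀ z : ℂ, |z.im| ≤ 1 →
      ‖F z‖ = Real.exp (signedKernel w c κ u z.re z.im - (cornerFreeDescentExt z).re) := by
    intro z hz
    rw [hF]
    dsimp only
    rw [Complex.norm_exp, Complex.sub_re, Complex.re_sum]
    have hS : ∑ i, ((w i : ℂ) * (∫ v in (-1:ℝ)..1, ((biweight v : ℝ) : ℂ) *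
        (((c i : ℂ) + Complex.I * (z - u i - κ i * v))⁻¹ + ((c i : ℂ) - Complex.I * (z - u i - κ i * v))⁻¹))).re
        = signedKernel w c κ u z.re z.im := by
      unfold signedKernel
      refine Finset.sum_congr rfl fun i _ => ?_
      rw [Complex.re_ofReal_mul, re_integral_probeC (c i) (κ i) (u i) z (lt_of_le_of_lt hz (hc i))]
    rw [hS]
  -- holomorphy at every point of the closed strip
  have hdiff : ∀ z : ℂ, |z.im| ≤ 1 → DifferentiableAt ℂ F z := by
    intro z hz
    rw [hF]
    refine DifferentiableAt.cexp ?_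
    refine (DifferentiableAt.fun_sum fun i _ => ?_).fun_sub (differentiableAt_cornerFreeDescentExt hz)
    exact (differentiableAt_integral_probeC (c i) (κ i) (u i) (lt_of_le_of_lt hz (hc i))).const_mul _
  -- bound on `k` on the closed strip
  have hk : ∀ z : ℂ, |z.im| ≤ 1 →
      signedKernel w c κ u z.re z.im ≤ ∑ i, |w i| * (2 / (c i - 1) * |(1:ℝ) - -1|) := by
    intro z hz
    unfold signedKernel
    refine Finset.sum_le_sum fun i _ => ?_
    have hb := abs_probeKernel_le (c i) (κ i) (u i) z.re z.im (hc i) hz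
    calc w i * probeKernel (c i) (κ i) (u i) z.re z.im
        ≤ |w i * probeKernel (c i) (κ i) (u i) z.re z.im| := le_abs_self _
      _ = |w i| * |probeKernel (c i) (κ i) (u i) z.re z.im| := abs_mul _ _
      _ ≤ |w i| * (2 / (c i - 1) * |(1:ℝ) - -1|) := mul_le_mul_of_nonneg_left hb (abs_nonneg _)
  -- the corner point `⟨ξ, η⟩` of evaluation is interior
  have hη' := abs_lt.mp hη
  have hne1 : (⟨ξ, η⟩ : ℂ) ≠ I := fun h => by
    have := congrArg Complex.im h; simp at this; linarith
  have hne2 : (⟨ξ, η⟩ : ℂ) ≠ -I := fun h => by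
    have := congrArg Complex.im h; simp at this; linarith
  -- the 1-D hypothesis at the corner `ξ = 0`: `k(0,1) ≤ 1`
  have h0 : signedKernel w c κ u 0 1 ≤ 1 := by have := h1D 0; norm_num at this; exact this
  have hPL := PhragmenLindelof.horizontal_strip (a := -1) (b := 1) (C := 1) (f := F) (z := ⟨ξ, η⟩)
    ?_ ?_ ?_ ?_ (by simpa using hη'.1.le) (by simpa using hη'.2.le)
  · rw [hnorm ⟨ξ, η⟩ hη.le, Real.exp_le_one_iff, cornerFreeDescentExt_of_ne hne1 hne2,
      re_cornerFreeDescentC] at hPL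
    change signedKernel w c κ u ξ η - (descentKernel ξ η - 2 * π * stripKernel η ξ) ≤ 0 at hPL
    linarith
  · -- `DiffContOnCl`
    refine ⟨fun z hz => (hdiff z (abs_lt.mpr hz).le).differentiableWithinAt, fun z hz => ?_⟩
    have hz' : z ∈ Complex.im ⁻¹' Icc (-1:ℝ) 1 :=
      closure_minimal (preimage_mono Ioo_subset_Icc_self) (isClosed_Icc.preimage Complex.continuous_im) hz
    exact (hdiff z (abs_le.mpr hz')).continuousAt.continuousWithinAt
  · -- growth: `F` is bounded on `|Re z| ≥ 1`
    refine ⟨0, ?_, 0, Asymptotics.IsBigO.of_bound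
      (Real.exp (∑ i, |w i| * (2 / (c i - 1) * |(1:ℝ) - -1|) + (4 + π))) ?_⟩
    · rw [show (1:ℝ) - -1 = 2 by norm_num]; positivity
    · have hmem : {z : ℂ | 1 ≤ |z.re|} ∈ Filter.comap (_root_.abs ∘ Complex.re) Filter.atTop :=
        Filter.preimage_mem_comap (Filter.Ici_mem_atTop (1:ℝ))
      filter_upwards [Filter.inter_mem_inf hmem (Filter.mem_principal_self (Complex.im ⁻¹' Ioo (-1:ℝ) 1))]
        with z hz
      obtain ⟨hre, hstrip⟩ := hz
      have hre : 1 ≤ |z.re| := hre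
      have him : |z.im| ≤ 1 := (abs_lt.mpr hstrip).le
      have hz1 : z ≠ I := fun h => by rw [h] at hre; norm_num at hre
      have hz2 : z ≠ -I := fun h => by rw [h] at hre; norm_num at hre
      have hG : -(cornerFreeDescentExt z).re ≤ 4 + π := by
        rw [cornerFreeDescentExt_of_ne hz1 hz2]
        have h1 := abs_re_le_norm (cornerFreeDescentC z)
        have h2 := norm_cornerFreeDescentC_le_far hre
        have h3 := neg_abs_le (cornerFreeDescentC z).re
        linarith
      simp only [zero_mul, Real.exp_zero, norm_one, mul_one]
      rw [hnorm z him, Real.exp_le_exp]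
      linarith [hk z him]
  · -- boundary line `Im z = -1`
    intro z hz
    have habs : |z.im| = 1 := by rw [hz]; norm_num
    rw [hnorm z habs.le, Real.exp_le_one_iff, hz, signedKernel_neg]
    by_cases hre : z.re = 0
    · rw [re_cornerFreeDescentExt_corner habs hre, hre]; linarith
    · rw [re_cornerFreeDescentExt_boundary habs hre]; linarith [h1D z.re]
  · -- boundary line `Im z = 1`
    intro z hz
    have habs : |z.im| = 1 := by rw [hz]; norm_num
    rw [hnorm z habs.le, Real.exp_le_one_iff, hz]
    by_cases hre : z.re = 0
    · rw [re_cornerFreeDescentExt_corner habs hre, hre]; linarith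
    · rw [re_cornerFreeDescentExt_boundary habs hre]; linarith [h1D z.re]

end Summit.RiemannHypothesis.RiemannHypothesis.Theorems.DbnTheory

end
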